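import Summits.FinalStateConjecture.FinalStateConjecture.Theorems.EIHFluxBalanceModulatedKerrHandoffOneHoleClock
import Summits.FinalStateConjecture.FinalStateConjecture.Theorems.EIHFluxBalanceModulatedKerrHandoffOneHoleModuli

/-!
# Route EIHFluxBalance — `ModulatedKerrHandoff`, stub `stub_oneHoleMatching`: lab and rest-frame kinematics

Helper file for the crux `stmt-FinalStateConjecture-10167`
(`Summit.FinalStateConjecture.FinalStateConjecture.Theses.EIHFluxBalance.ModulatedKerrHandoff`),
line `photon-rocket-modulation`, stub `stub_oneHoleMatching` (one-hole profile matching).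

Elementary kinematics of one hole with world-line `ξ` (speed `≤ v < 1`), aligned boosts
`Λ(u)e₀ = γ(u)(1, ξ′(u))` of Lorentz factor `≤ γ`, and retarded clock `U` (`x⁰ − U x = ‖x̲ − ξ(U x)‖`):

* the two rest-frame positions of a lab point `x` on the slab `x⁰ = t` — INSTANTANEOUS,
  `Y₀ = S Λ(t)⁻¹(x − c(t))`, and RETARDED, `Y₁ = S Λ(U x)⁻¹(x − c(U x))` — have sizes comparable to
  the lab distance `d = ‖x̲ − ξ(t)‖` and the retardation `Δ = t − U x`: `d ≤ ‖Y₀‖ ≤ (1 + 3γ) d`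
  (boosts stretch spatial vectors) and `(1 − v) Δ ≤ ‖Y₁‖ ≤ 2 (1 + 3γ) Δ` (the retarded separation
  `x − c(U x)` is NULL, and its rest-frame time component is `γ_U (Δ − ⟨x̲ − ξ(U), ξ′(U)⟩) ≥ (1 − v)Δ`
  by alignment; Kinnersley 1969, §2);
* the late-time regimes: on the cone `‖x̲‖ ≤ κ t` the retarded time is eventually `≥ (1 − κ) t / 2`
  (`exists_forall_cone_clock_ge`), and wherever `d ≤ (1 − v) t / 2` it is `≥ t / 2`
  (`clock_ge_half`), so tameness of the moduli applies there; the size of the point itself,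
  `‖x‖ ≤ t + d + ‖ξ(t)‖`.
-/

noncomputable section

-- `Summit.<S>.<S>.…` (single-problem summit, D-0017) trips core's duplicate-namespace linter.
set_option linter.dupNamespace false

open Set Filter Function Literature.Geometry.Lorentzian
open scoped Topology ContDiff

namespace Summit.FinalStateConjecture.FinalStateConjecture.Theorems

namespace OneHole

/-! ### Rest-frame sizes -/

/-- Invariance moved to the inverse: `η(Λ⁻¹ q, p) = η(q, Λ p)`. [folklore] -/
theorem bilin_symm_apply (Λ : lorentzGroup) (q p : E4) :
    Minkowski.bilin ((Λ : E4 ≃L[ℝ] E4).symm q) p = Minkowski.bilin q ((Λ : E4 ≃L[ℝ] E4) p) := by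
  have h := Λ.2 ((Λ : E4 ≃L[ℝ] E4).symm q) p
  rw [ContinuousLinearEquiv.apply_symm_apply] at h
  exact h.symm

/-- **Instantaneous rest-frame position versus lab distance**: for `x⁰ = t`,
`‖x̲ − ξ(t)‖ ≤ ‖S Λ⁻¹(x − (t, ξ t))‖ ≤ (1 + 3γ) ‖x̲ − ξ(t)‖` (boosts stretch spatial vectors; operator
norm of `Λ⁻¹`). [folklore] -/
theorem norm_restPosition_inst {Λ : lorentzGroup} {γ : ℝ} {x : E4} {t : ℝ} (hx : x 0 = t) (ξt : E3)
    (h1 : 1 ≤ ((Λ : E4 ≃L[ℝ] E4) (E4.basisVector 0)) 0) (hγ : ((Λ : E4 ≃L[ℝ] E4) (E4.basisVector 0)) 0 ≤ γ) :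
    ‖E4.spatial x - ξt‖ ≤ ‖E4.spatial ((Λ : E4 ≃L[ℝ] E4).symm (x - E4.ofTimeSpace t ξt))‖ ∧
      ‖E4.spatial ((Λ : E4 ≃L[ℝ] E4).symm (x - E4.ofTimeSpace t ξt))‖ ≤ (1 + 3 * γ) * ‖E4.spatial x - ξt‖ := by
  obtain ⟨h0, hn⟩ := sub_ofTimeSpace_apply_zero hx ξt
  constructor
  · have h := norm_le_spatialNorm_lorentz_apply Λ⁻¹ h0
    rw [coe_lorentz_inv, hn] at h
    exact h
  · have hS : ‖E4.spatial ((Λ : E4 ≃L[ℝ] E4).symm (x - E4.ofTimeSpace t ξt))‖ ≤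
        ‖(Λ : E4 ≃L[ℝ] E4).symm (x - E4.ofTimeSpace t ξt)‖ :=
      (E4.spatial.le_opNorm _).trans (mul_le_of_le_one_left (norm_nonneg _) norm_spatial_le)
    refine hS.trans ?_
    have h := (((Λ : E4 ≃L[ℝ] E4).symm : E4 ≃L[ℝ] E4) : E4 →L[ℝ] E4).le_opNorm (x - E4.ofTimeSpace t ξt)
    rw [ContinuousLinearEquiv.coe_coe, hn] at h
    exact h.trans (mul_le_mul_of_nonneg_right (norm_theta_le h1 hγ) (norm_nonneg _))

/-- **Retarded rest-frame position, lower bound**: if `x⁰ − u = ‖x̲ − ξ(u)‖` (retarded separation null)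
and `Λ e₀ = g (1, V)` with `g ≥ 1`, `‖V‖ ≤ v`, then `(1 − v)(x⁰ − u) ≤ ‖S Λ⁻¹(x − (u, ξ u))‖`: the
rest-frame image is null with time component `g((x⁰ − u) − ⟨x̲ − ξ(u), V⟩)` (Kinnersley 1969, §2).
[folklore] -/
theorem retardation_le_norm_restPosition_ret {Λ : lorentzGroup} {V ξu : E3} {g v : ℝ} {x : E4} {u : ℝ}
    (hclock : x 0 - u = ‖E4.spatial x - ξu‖) (hal : (Λ : E4 ≃L[ℝ] E4) (E4.basisVector 0) = g • E4.ofTimeSpace 1 V)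
    (hg : 1 ≤ g) (hV : ‖V‖ ≤ v) (hv1 : v < 1) :
    (1 - v) * (x 0 - u) ≤ ‖E4.spatial ((Λ : E4 ≃L[ℝ] E4).symm (x - E4.ofTimeSpace u ξu))‖ := by
  set q : E4 := x - E4.ofTimeSpace u ξu with hq
  set p : E4 := (Λ : E4 ≃L[ℝ] E4).symm q with hp
  have hΔ : 0 ≤ x 0 - u := by rw [hclock]; exact norm_nonneg _
  have hq0 : q 0 = x 0 - u := by simp [hq]
  have hqs : E4.spatial q = E4.spatial x - ξu := by
    rw [hq, map_sub, E4.spatial_ofTimeSpace]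
  -- `q` is null, hence so is `p`
  have hnull : Minkowski.bilin p p = 0 := by
    have hinv : Minkowski.bilin p p = Minkowski.bilin q q := by
      rw [hp, bilin_symm_apply, ContinuousLinearEquiv.apply_symm_apply]
    rw [hinv, minkowski_bilin_self, hq0, E4.spatialNorm, hqs, ← hclock]
    ring
  have hp0 : (p 0) ^ 2 = E4.spatialNorm p ^ 2 := by
    have h := minkowski_bilin_self p
    rw [hnull] at h
    linarith
  -- time component of `p`
  have htime : p 0 = g * ((x 0 - u) - inner ℝ (E4.spatial x - ξu) V) := by
    have h1 := minkowski_bilin_basisVector_zero_left p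
    rw [Minkowski.bilin_symm] at h1
    have h2 : Minkowski.bilin p (E4.basisVector 0) = Minkowski.bilin q ((Λ : E4 ≃L[ℝ] E4) (E4.basisVector 0)) :=
      bilin_symm_apply Λ q _
    rw [hal, map_smul, smul_eq_mul] at h2
    have h3 : Minkowski.bilin q (E4.ofTimeSpace 1 V) = -(x 0 - u) + inner ℝ (E4.spatial x - ξu) V := by
      rw [Minkowski.bilin_apply, hq0, E4.ofTimeSpace_apply_zero, mul_one]
      congr 1
      rw [← hqs]
      rw [show inner ℝ (E4.spatial q) V = ∑ i : Fin 3, inner ℝ (E4.spatial q i) (V i) from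
        PiLp.inner_apply _ _]
      refine Finset.sum_congr rfl fun i _ ↦ ?_
      rw [E4.spatial_apply, E4.ofTimeSpace_apply_succ, real_inner_eq_re_inner]
      simp [mul_comm]
    rw [h3] at h2
    linarith
  have hinner : inner ℝ (E4.spatial x - ξu) V ≤ (x 0 - u) * v := by
    refine (real_inner_le_norm _ _).trans ?_
    rw [← hclock]
    exact mul_le_mul_of_nonneg_left hV hΔ
  have hp0ge : (1 - v) * (x 0 - u) ≤ p 0 := by
    rw [htime]
    have : (1 - v) * (x 0 - u) ≤ 1 * ((x 0 - u) - inner ℝ (E4.spatial x - ξu) V) := by nlinarith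
    refine this.trans ?_
    have hpos : 0 ≤ (x 0 - u) - inner ℝ (E4.spatial x - ξu) V := by nlinarith
    exact mul_le_mul_of_nonneg_right hg hpos
  have hsp : p 0 ≤ E4.spatialNorm p := by
    have := E4.spatialNorm_nonneg p
    nlinarith [hp0]
  exact hp0ge.trans (hsp.trans (le_of_eq rfl))

/-- **Retarded rest-frame position, upper bound**: `‖S Λ⁻¹(x − (u, ξ u))‖ ≤ 2 (1 + 3γ)(x⁰ − u)` when
`x⁰ − u = ‖x̲ − ξ(u)‖` (the null separation has Euclidean norm `√2 Δ ≤ 2Δ`). [folklore] -/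
theorem norm_restPosition_ret_le {Λ : lorentzGroup} {ξu : E3} {γ : ℝ} {x : E4} {u : ℝ}
    (hclock : x 0 - u = ‖E4.spatial x - ξu‖)
    (h1 : 1 ≤ ((Λ : E4 ≃L[ℝ] E4) (E4.basisVector 0)) 0) (hγ : ((Λ : E4 ≃L[ℝ] E4) (E4.basisVector 0)) 0 ≤ γ) :
    ‖x - E4.ofTimeSpace u ξu‖ ≤ 2 * (x 0 - u) ∧
    ‖E4.spatial ((Λ : E4 ≃L[ℝ] E4).symm (x - E4.ofTimeSpace u ξu))‖ ≤ 2 * (1 + 3 * γ) * (x 0 - u) := by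
  set q : E4 := x - E4.ofTimeSpace u ξu with hq
  have hΔ : 0 ≤ x 0 - u := by rw [hclock]; exact norm_nonneg _
  have hq0 : q 0 = x 0 - u := by simp [hq]
  have hqs : E4.spatialNorm q = x 0 - u := by
    rw [E4.spatialNorm, hq, map_sub, E4.spatial_ofTimeSpace, ← hclock]
  have hqn : ‖q‖ ≤ 2 * (x 0 - u) := by
    have h := norm_sq_eq_sq_add_spatialNorm_sq q
    rw [hq0, hqs] at h
    nlinarith [norm_nonneg q]
  refine ⟨hqn, ?_⟩
  have hS : ‖E4.spatial ((Λ : E4 ≃L[ℝ] E4).symm q)‖ ≤ ‖(Λ : E4 ≃L[ℝ] E4).symm q‖ :=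
    (E4.spatial.le_opNorm _).trans (mul_le_of_le_one_left (norm_nonneg _) norm_spatial_le)
  refine hS.trans ?_
  have h := (((Λ : E4 ≃L[ℝ] E4).symm : E4 ≃L[ℝ] E4) : E4 →L[ℝ] E4).le_opNorm q
  rw [ContinuousLinearEquiv.coe_coe] at h
  refine h.trans ?_
  calc _ ≤ (1 + 3 * γ) * (2 * (x 0 - u)) :=
        mul_le_mul (norm_theta_le h1 hγ) hqn (norm_nonneg _) (by linarith)
    _ = 2 * (1 + 3 * γ) * (x 0 - u) := by ring

/-! ### The size of the lab point -/

/-- `‖x‖ ≤ |x⁰| + ‖x̲ − ξ(x⁰)‖ + ‖ξ(x⁰)‖`. [folklore] -/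
theorem norm_point_le (x : E4) (ξt : E3) : ‖x‖ ≤ |x 0| + ‖E4.spatial x - ξt‖ + ‖ξt‖ := by
  have h := norm_sq_eq_sq_add_spatialNorm_sq x
  have h1 : ‖x‖ ≤ |x 0| + E4.spatialNorm x := by
    nlinarith [norm_nonneg x, abs_nonneg (x 0), E4.spatialNorm_nonneg x, sq_abs (x 0)]
  have h2 : E4.spatialNorm x ≤ ‖E4.spatial x - ξt‖ + ‖ξt‖ := by
    rw [E4.spatialNorm]
    exact norm_le_norm_sub_add _ _
  linarith

/-! ### Late-time regimes of the retarded clock -/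

section Regimes

variable {ξ : ℝ → E3} {v κ : ℝ} {Uc : E4 → ℝ}

/-- **Near the hole the retarded time is late**: if `‖x̲ − ξ(x⁰)‖ ≤ (1 − v) x⁰ / 2` then
`U x ≥ x⁰ / 2` (`(1 − v)(x⁰ − U x) ≤ d`). [folklore] -/
theorem clock_ge_half (hξ : ContDiff ℝ ∞ ξ) (hv0 : 0 ≤ v) (hv1 : v < 1) (hv : ∀ u, ‖deriv ξ u‖ ≤ v)
    (hclock : ∀ x, x 0 - Uc x = ‖E4.spatial x - ξ (Uc x)‖) {x : E4}
    (hd : ‖E4.spatial x - ξ (x 0)‖ ≤ (1 - v) * x 0 / 2) : x 0 / 2 ≤ Uc x := by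
  have h := retardation_le_dist hξ hv0 hv hclock x
  have h1v : 0 < 1 - v := by linarith
  nlinarith

/-- **On the cone the retarded time is eventually late**: if `‖ξ(s)‖ ≤ κ² s` for large `s` then there is
`T` such that every `x` with `x⁰ ≥ T` and `‖x̲‖ ≤ κ x⁰` has `U x ≥ (1 − κ) x⁰ / 2` (if `U x` were
early the centre, moving at speed `< 1`, could not be within light-travel distance; Kinnersley 1969,
§2). [folklore] -/
theorem exists_forall_cone_clock_ge (hξ : ContDiff ℝ ∞ ξ) (hv0 : 0 ≤ v) (hv1 : v < 1)
    (hv : ∀ u, ‖deriv ξ u‖ ≤ v) (hclock : ∀ x, x 0 - Uc x = ‖E4.spatial x - ξ (Uc x)‖)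
    (hκ0 : 0 < κ) (hκ1 : κ < 1) (hcone : ∀ᶠ s in atTop, ‖ξ s‖ ≤ κ ^ 2 * s) :
    ∃ T : ℝ, 0 < T ∧ ∀ x : E4, T ≤ x 0 → E4.spatialNorm x ≤ κ * x 0 → (1 - κ) * x 0 / 2 ≤ Uc x := by
  obtain ⟨T₁, hT₁⟩ := eventually_atTop.mp hcone
  set T₀ : ℝ := max T₁ 0 with hT₀
  have hT₀' : ∀ s, T₀ ≤ s → ‖ξ s‖ ≤ κ ^ 2 * s := fun s hs ↦ hT₁ s ((le_max_left _ _).trans hs)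
  set C₁ : ℝ := T₀ + ‖ξ T₀‖ with hC₁
  refine ⟨max 1 (C₁ / (1 - κ) + 1), lt_max_of_lt_left one_pos, fun x hx hsx ↦ ?_⟩
  set t := x 0 with ht
  set U := Uc x with hU
  have hΔ : 0 ≤ t - U := retardation_nonneg hclock x
  have ht0 : 0 ≤ t := le_trans (by positivity) ((le_max_left _ _).trans hx)
  have hΔle : t - U ≤ κ * t + ‖ξ U‖ := by
    rw [ht, hU, hclock x]
    have h1 : ‖E4.spatial x - ξ (Uc x)‖ ≤ ‖E4.spatial x‖ + ‖ξ (Uc x)‖ := norm_sub_le _ _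
    have h2 : ‖E4.spatial x‖ ≤ κ * x 0 := hsx
    linarith
  have h1κ : 0 < 1 - κ := by linarith
  rcases le_or_gt T₀ U with hU₁ | hU₁
  · -- late retarded time: `‖ξ U‖ ≤ κ² U ≤ κ² t`
    have h1 := hT₀' U hU₁
    have h5 : (1 - κ) * t ≤ (1 + κ ^ 2) * U := by nlinarith
    have h6 : 0 ≤ (1 - κ) * t := by positivity
    have hU0 : 0 ≤ U := by
      by_contra hneg
      rw [not_le] at hneg
      nlinarith [sq_nonneg κ]
    have h7 : κ ^ 2 ≤ 1 := by nlinarith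
    have h8 : (1 + κ ^ 2) * U ≤ 2 * U := by nlinarith
    linarith
  · -- early retarded time is impossible for large `t`
    exfalso
    have hlip := norm_sub_le_of_deriv_le hξ hv0 hv U T₀
    have h2 : ‖ξ U‖ ≤ ‖ξ T₀‖ + v * (T₀ - U) := by
      rw [abs_of_neg (by linarith)] at hlip
      have := norm_le_norm_sub_add (ξ U) (ξ T₀)
      linarith
    have h3 : (1 - κ) * t ≤ C₁ := by
      have hUT : U * (1 - v) ≤ T₀ * (1 - v) := mul_le_mul_of_nonneg_right hU₁.le (by linarith)
      rw [hC₁]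
      nlinarith
    have h4 : C₁ / (1 - κ) + 1 ≤ t := (le_max_right _ _).trans hx
    rw [div_add_one h1κ.ne', div_le_iff₀ h1κ] at h4
    nlinarith

/-- On the cone the lab distance to the centre is eventually at most `2 x⁰`:
`‖x̲ − ξ(x⁰)‖ ≤ κ x⁰ + κ² x⁰ ≤ 2 x⁰`. [folklore] -/
theorem dist_le_two_mul_of_cone (hκ0 : 0 < κ) (hκ1 : κ < 1) {x : E4} (hsx : E4.spatialNorm x ≤ κ * x 0)
    (hξx : ‖ξ (x 0)‖ ≤ κ ^ 2 * x 0) (hx : 0 ≤ x 0) : ‖E4.spatial x - ξ (x 0)‖ ≤ 2 * x 0 := by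
  have h := norm_sub_le (E4.spatial x) (ξ (x 0))
  rw [← E4.spatialNorm] at h
  have h1 : κ * x 0 ≤ x 0 := by nlinarith
  have h2 : κ ^ 2 * x 0 ≤ x 0 := by nlinarith [sq_nonneg κ, mul_pos hκ0 hκ0]
  linarith

end Regimes

end OneHole

/-- Registered sub-goal form (stub `oneHole_clock_ge_half` of the crux item) of `OneHole.clock_ge_half`:
near the hole the retarded time is late, `d ≤ (1 − v)x⁰/2 ⇒ U x ≥ x⁰/2` (Kinnersley 1969, §2). [folklore] -/
theorem oneHole_clock_ge_half : open Literature.Geometry.Lorentzian in ∀ {ξ : ℝ → E3} {v : ℝ} {Uc : E4 → ℝ}, ContDiff ℝ ((⊤ : ℕ∞) : WithTop ℕ∞) ξ → 0 ≤ v → v < 1 → (∀ u, ‖deriv ξ u‖ ≤ v) → (∀ x, x 0 - Uc x = ‖E4.spatial x - ξ (Uc x)‖) → ∀ {x : E4}, ‖E4.spatial x - ξ (x 0)‖ ≤ (1 - v) * x 0 / 2 → x 0 / 2 ≤ Uc x :=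
  fun hξ hv0 hv1 hv hclock _ hd ↦ OneHole.clock_ge_half hξ hv0 hv1 hv hclock hd

end Summit.FinalStateConjecture.FinalStateConjecture.Theorems

end
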